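import Summits.NavierStokesRegularity.NavierStokesRegularity.Theorems.CalmPocketDoorDefs
import Literature.Analysis.FluidPDE.BarkerPrange2021TypeICriteria
import Literature.Analysis.FluidPDE.SereginSverakPressureProofs
import Literature.Analysis.FluidPDE.ClassicalTopPointRegularity
import HarnessLib

/-!
# CalmPocketDoorBP32 — door S32 «CalmPocketDoor» (texts nsreg-p1 g25 `r30/Sketch32.lean` v2 d8e333116c9f1838, tree
# `…Theorems.CalmPocketDoorDefs`), plate BP32: the S-lemma from the tree's Barker–Prange fact to `BP21CalmShellRegularity`

`bp21CalmShellRegularity_of : Literature.Analysis.FluidPDE.barkerPrange2021_regular_of_relative_smallness → BP21CalmShellRegularity`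
(typer g24's recipe 2026-08-28T11:48:17Z; planner nsreg-p1 g26 (a)): instantiate the EFFECTIVE Literature fact (Barker–Prange 2021,
Prop. 10, typed 2026-08-26 as `barkerPrange2021_regular_of_relative_smallness`: `∃ M₀ ≥ 1, ∃ L > 0, ∀ M ≥ M₀, ∀ ν T > 0, …`) at
`ν = T = 1`, `M' = max M M₀`, `R = exp((exp(L M'⁵/2))^1221) > 1`, and `δ = η / ((vol B̄(0,R))^{1/3} + 1)` with
`η = exp(−exp((exp(L M'⁵/2))^1223))`, so that the a.e.-sup bound `‖u 1‖ ≤ δ` on the closed shell `{1 ≤ ‖x‖ ≤ R}` gives the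
`L³` bound `≤ η` on Barker–Prange's half-open annulus (`eLpNorm_le_of_ae_bound` + monotonicity); the class «classical on `[0,1)` +
Leray–Hopf on `[0,1]`» is suitable on the open slab with the GAUGED pressure (`SereginSverak2002.isSuitableWeakSolutionOn_gauge_of_classical`
— the fact quantifies over all pressures); the conclusion `eLpNorm (uncurry u) ∞ < ∞` on a backward cylinder at `(1,0)` becomes
`IsBackwardBoundedAt u 1 0` by continuity of the classical `u` below `t = 1` (`exists_forall_norm_le_of_eLpNorm_top_lt_top`).

Width-seat file (prover ns-imp-p1 g4 on LEAD ns-s30-p1 g2's word 11:59:45Z, S-door lane DIRECTOR-NS #209 (2)),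
`--supports stmt-NavierStokesRegularity-0056 --as helper`.  HONEST FRAMING: `BP21CalmShellRegularity` is thereby CONDITIONAL on the
unproved Literature fact (Barker–Prange 2021 Prop. 10, a printed theorem not yet formalised); S32 is a regularity CRITERION about
HYPOTHETICAL blow-up profiles; item 0056 `NoTypeII` / NS regularity NOT proved.
-/

noncomputable section

set_option linter.dupNamespace false

namespace Summit.NavierStokesRegularity.NavierStokesRegularity.Theorems.CalmPocketDoor

open MeasureTheory Set Function Filter Topology TopologicalSpace Metric
open scoped ENNReal Topology
open Literature.Analysis Literature.Analysis.FluidPDE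

/-- An a.e.-sup bound on a set of finite measure gives an `L³` bound on every measurable subset:
`‖f‖_{L³(A)} ≤ (vol S)^{1/3} δ` for `A ⊆ S`. -/
theorem eLpNorm_three_restrict_le_of_ae_bound {f : EuclideanSpace ℝ (Fin 3) → EuclideanSpace ℝ (Fin 3)}
    {S A : Set (EuclideanSpace ℝ (Fin 3))} {δ : ℝ} (hAS : A ⊆ S)
    (h : ∀ᵐ x ∂(volume.restrict S), ‖f x‖ ≤ δ) :
    eLpNorm f 3 (volume.restrict A) ≤ volume S ^ (3 : ℝ)⁻¹ * ENNReal.ofReal δ := by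
  have hA : ∀ᵐ x ∂(volume.restrict A), ‖f x‖ ≤ δ := ae_restrict_of_ae_restrict_of_subset hAS h
  have h1 := eLpNorm_le_of_ae_bound (p := (3 : ℝ≥0∞)) hA
  rw [Measure.restrict_apply_univ] at h1
  refine h1.trans ?_
  have e3 : (3 : ℝ≥0∞).toReal⁻¹ = (3 : ℝ)⁻¹ := by norm_num
  rw [e3]
  gcongr

/-- **Plate BP32 (S-lemma).**  The tree's effective Barker–Prange fact implies the door's `BP21CalmShellRegularity`. -/
theorem bp21CalmShellRegularity_of (hBP : barkerPrange2021_regular_of_relative_smallness) : BP21CalmShellRegularity := by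
  obtain ⟨M₀, hM₀, L, hL, hfact⟩ := hBP
  intro M hM
  -- constants
  set M' : ℝ := max M M₀ with hM'_def
  have hM'₀ : M₀ ≤ M' := le_max_right _ _
  have hMM' : M ≤ M' := le_max_left _ _
  set Mb : ℝ := Real.exp (L * M' ^ 5 / 2) with hMb_def
  set R : ℝ := Real.exp (Mb ^ (1221 : ℕ)) with hR_def
  set η : ℝ := Real.exp (-Real.exp (Mb ^ (1223 : ℕ))) with hη_def
  have hMb : 0 < Mb := Real.exp_pos _
  have hR1 : 1 < R := by
    have h1 : (0 : ℝ) < Mb ^ (1221 : ℕ) := pow_pos hMb _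
    have h2 := Real.add_one_lt_exp h1.ne'
    rw [hR_def]; linarith
  have hR0 : 0 < R := by linarith
  have hη : 0 < η := Real.exp_pos _
  set V : ℝ := ((volume : Measure (EuclideanSpace ℝ (Fin 3))) (closedBall (0 : EuclideanSpace ℝ (Fin 3)) R)).toReal
    with hV_def
  have hV0 : 0 ≤ V := ENNReal.toReal_nonneg
  set δ : ℝ := η / (V ^ (3 : ℝ)⁻¹ + 1) with hδ_def
  have hV3 : 0 ≤ V ^ (3 : ℝ)⁻¹ := Real.rpow_nonneg hV0 _
  have hδ : 0 < δ := by positivity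
  refine ⟨R, δ, hR1, hδ, fun u p hsol hLH hL3 hshell => ?_⟩
  -- the class is suitable on the open slab, with the gauged pressure
  have hsuit := SereginSverak2002.isSuitableWeakSolutionOn_gauge_of_classical one_pos one_pos hsol hLH
    (slab (EuclideanSpace ℝ (Fin 3)) (Ioo (0 : ℝ) 1) isOpen_Ioo) (fun z hz => hz)
  -- the datum bound at level `M'`
  have hL3' : eLpNorm (u 0) 3 volume ≤ ENNReal.ofReal (1 * M') := by
    rw [one_mul]; exact hL3.trans (ENNReal.ofReal_le_ofReal hMM')
  -- the `L³` bound on Barker–Prange's annulus from the a.e.-sup bound on the closed shell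
  set S : Set (EuclideanSpace ℝ (Fin 3)) := {x | 1 ≤ ‖x‖ ∧ ‖x‖ ≤ R} with hS_def
  set A : Set (EuclideanSpace ℝ (Fin 3)) :=
    {x | Real.sqrt (1 * 1) ≤ ‖x‖ ∧ ‖x‖ < Real.sqrt (1 * 1) * Real.exp (Real.exp (L * M' ^ 5 / 2) ^ (1221 : ℕ))}
    with hA_def
  have hAS : A ⊆ S := by
    intro x hx
    obtain ⟨h1, h2⟩ := hx
    rw [mul_one, Real.sqrt_one] at h1 h2
    rw [one_mul] at h2
    exact ⟨h1, h2.le⟩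
  have hSball : S ⊆ closedBall (0 : EuclideanSpace ℝ (Fin 3)) R := fun x hx => by
    rw [mem_closedBall, dist_zero_right]; exact hx.2
  have hvolS : volume S ≤ ENNReal.ofReal V := by
    rw [hV_def, ENNReal.ofReal_toReal measure_closedBall_lt_top.ne]
    exact measure_mono hSball
  have hann : eLpNorm (u 1) 3 (volume.restrict A) ≤ ENNReal.ofReal (1 * η) := by
    refine (eLpNorm_three_restrict_le_of_ae_bound hAS hshell).trans ?_
    rw [one_mul]
    calc volume S ^ (3 : ℝ)⁻¹ * ENNReal.ofReal δ
        ≤ ENNReal.ofReal V ^ (3 : ℝ)⁻¹ * ENNReal.ofReal δ := by gcongr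
      _ = ENNReal.ofReal (V ^ (3 : ℝ)⁻¹ * δ) := by
          rw [ENNReal.ofReal_rpow_of_nonneg hV0 (by norm_num), ENNReal.ofReal_mul hV3]
      _ ≤ ENNReal.ofReal η := by
          refine ENNReal.ofReal_le_ofReal ?_
          rw [hδ_def, mul_div_assoc']
          rw [div_le_iff₀ (by positivity)]
          nlinarith
  -- Barker–Prange, Prop. 10, at `ν = T = 1`
  obtain ⟨r, hr, hfin⟩ := hfact M' hM'₀ 1 1 one_pos one_pos (u 0) u _ hLH hsuit hL3' hann
  -- essential bound on a backward cylinder below `t = 1` ⇒ pointwise bound (continuity)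
  set r' : ℝ := min r 1 with hr'_def
  have hr' : 0 < r' := lt_min hr one_pos
  have hr'r : r' ≤ r := min_le_left _ _
  have hr'1 : r' ≤ 1 := min_le_right _ _
  have hsub : parabolicCylinder r' (((1 : ℝ), (0 : EuclideanSpace ℝ (Fin 3))) : ℝ × EuclideanSpace ℝ (Fin 3)) ⊆
      parabolicCylinder r (((1 : ℝ), (0 : EuclideanSpace ℝ (Fin 3))) : ℝ × EuclideanSpace ℝ (Fin 3)) :=
    parabolicCylinder_mono hr'.le hr'r _
  have hfin' : eLpNorm (uncurry u) ⊤
      (volume.restrict (parabolicCylinder r' (((1 : ℝ), (0 : EuclideanSpace ℝ (Fin 3))) : ℝ × EuclideanSpace ℝ (Fin 3)))) < ⊤ :=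
    (eLpNorm_mono_measure _ (Measure.restrict_mono hsub le_rfl)).trans_lt hfin
  have hcont : ContinuousOn (uncurry u)
      (parabolicCylinder r' (((1 : ℝ), (0 : EuclideanSpace ℝ (Fin 3))) : ℝ × EuclideanSpace ℝ (Fin 3))) := by
    refine hsol.smooth_velocity.continuousOn.mono fun z hz => ?_
    rw [mem_parabolicCylinder] at hz
    refine ⟨⟨?_, by simpa using hz.1.2⟩, mem_univ _⟩
    have h1 : (1 : ℝ) - r' ^ 2 < z.1 := by simpa using hz.1.1
    nlinarith
  have hbd := exists_forall_norm_le_of_eLpNorm_top_lt_top (isOpen_parabolicCylinder r' _) hcont hfin'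
  refine ⟨r', hr', _, fun t ht x hx => hbd (t, x) ?_⟩
  rw [mem_parabolicCylinder]
  exact ⟨by simpa using ht, by simpa using hx⟩

end Summit.NavierStokesRegularity.NavierStokesRegularity.Theorems.CalmPocketDoor

end
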